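/-
Copyright (c) 2026 the pub-hodgecm-mathlib formalisation cell (harness21).  Prover seat hodgecm-mathlib-K2E3-p20 (g3), Track B «K2-LIT» ∕ h413 =
`stmt-HodgeConjecture-24833`, line `K2_E3_EllipticInputs`, unit U12 «Characters», socket #11 road (SC-an), END-GAME MAP v1 (K2 bus 2026-09-04T02:08:19Z)
brick [M4]: Harish-Chandra's Theorem 20 PAYS the truncated character integral of a supercuspidal coefficient at a split-regular element — on the
field model `U(σ, Φ₃)(K)`, for `g = y t y⁻¹` with `t` regular diagonal, `∫_{Ω n ∖ Ω R} θ(x g x⁻¹) dx = 0` for one `R = R(g)` and all `n`; hence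
`Θₙ(g) = ∫_{Ω n ∩ Ω R}` (the `hcanc` shape) and `Θₙ(g) → Θ_R(g)` (the `hlim` shape).  Line lead K2E3-p20 (g3); Theorem 20 itself ★ K2E3-p21 (g3) ∕ K2E3-p14 (g3).
-/
import Summits.HodgeConjecture.HodgeConjecture.Theorems.K2E3CuspFormCancellationU3LevelOne         -- ★ p856721 (K2E3-p21): THEOREM 20 on the full level `K₁` at `U(σ,Φ₃)(K)`
import Summits.HodgeConjecture.HodgeConjecture.Theorems.K2E3SupercuspOrbitalSliceCuspidalModel     -- ★ p856720 (this seat) [M1]: the supercuspidal slice is a cusp form (`hcusp`, `hcuspbar`, continuity)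
import Summits.HodgeConjecture.HodgeConjecture.Theorems.K2E3RightInvariantSetIntegralVanishing     -- ★ p856678 (this seat) (f1): shells of right-`K`-invariant sets; `hcanc`∕`hlim` shapes
import Literature.NumberTheory.Automorphic.UnitaryGroupCongruenceIwahoriFactorisation              -- ★ `isCompact_isOpen_comap_congruenceGL`
import HarnessLib

/-!
# K2_E3 road (h413), socket #11 (SC-an), [M4]: THEOREM 20 PAYS THE TRUNCATED SUPERCUSPIDAL CHARACTER AT SPLIT-REGULAR ELEMENTS —
# `∫_{Ω n ∖ Ω R(g)} θ(x g x⁻¹) dx = 0`, `Θₙ(g) = ∫_{Ω n ∩ Ω R(g)}`, `Θₙ(g) → Θ_{R(g)}(g)` on `U(σ, Φ₃)(K)`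

Cell `pub/hodgecm-mathlib`, Track B «K2-LIT», crux H413 = `stmt-HodgeConjecture-24833` (`--supports … --as helper`, count-neutral).  [HarishChandra1970, VII §3
p. 71 eq. (1)] read WITHOUT Theorem 18: for `g = y t y⁻¹` (`t ∈ T` regular) and `θ = B u' (ρ(·) u)` a coefficient of a smooth SUPERCUSPIDAL `ρ`,
`θ(x g x⁻¹) = f_t(x y)` with `f_t ∈ Φ_C` (★ [M1] `K2E3SupercuspOrbitalSliceCuspidalModel`: continuous, cuspidal along `N` and `N̄` for every Haar measure;
support `⊆ C·T` — the hypothesis `hsupp`, Harish-Chandra's Lemma 14, discharged at `K = L_w` by [M2]); THEOREM 20 on the full level (★ [M3]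
`cuspForm_cancellation_levelOne_U3_of_isCompact`, K2E3-p21 (g3) over ★ K2E3-p14 (g3)) gives `∫_{K₁} f_t(x k y) dk = 0` for `y ∈ Ω_s`, `x ∉ Ω_R`,
`R = m_C + (1 + 2s + 4m_C) + s`; the shell `Ω n ∖ Ω R` is right-`K₁`-invariant (`K₁ ⊆ Ω 0` ★ `coe_level_subset_heightBall_zero`, `hmul`, `hinv`), so ★ (f1)
`setIntegral_eq_zero_of_forall_setIntegral_mul_eq_zero` kills `∫_{Ω n ∖ Ω R} θ(xgx⁻¹) dx`, and ★ (f1) §4 yields the two consumer shapes.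

* **`setIntegral_sdiff_heightBall_coeff_conj_eq_zero`** — the shell vanishing, `∃ R, ∀ n, ∫ x in Ω n ∖ Ω R, θ(x (y t y⁻¹) x⁻¹) dμ = 0`;
* **`exists_heightBall_truncatedCoeff_eq_inter_and_tendsto`** — `∃ R, (∀ n, Θₙ = ∫_{Ω n ∩ Ω R}) ∧ Θₙ → Θ_R` (the `hcanc`∕`hlim` shapes of ★
  `K2E3SupercuspidalTruncatedCharDominationOfBricks` ∕ ★ `K2E3CharLocIntNearSemisimpleSupercuspidalOfTruncated` at a split-regular `g`, model side).

Currency: K2E3-p21 (g3)'s (`K` with compatible `Valued K ℤᵐ⁰`∕`ValuativeRel`, `IsNonarchimedeanLocalField K`; `σ` an isometric continuous involution; a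
uniformiser `ϖ`; `Ω : CompactExhaustion U` with ★ p856390's `hmem`∕`hinv`∕`hmul`; `μ` left+right Haar) + [M1]'s (`2 ≠ 0`, scalar and compact centre, a
`σ`-fixed `ϖ'` with `0 < |ϖ'| < 1`); all discharged at `K = L_w` in [M2].

HONEST LABEL: HC_CM is proved only modulo the 7 printed citations (2 remaining named inputs: hLiu418 = stmt-HodgeConjecture-24832, h413 =
stmt-HodgeConjecture-24833) until rung 0 closes; this file is a count-neutral helper.

## References
* [HarishChandra1970] Harish-Chandra (notes by G. van Dijk), *Harmonic Analysis on Reductive p-adic Groups*, LNM 162 (1970), Part VII §2 Theorem 20 p. 70;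
  §3 p. 71 eq. (1), p. 72.
* [Rogawski1990] J. D. Rogawski, *Automorphic Representations of Unitary Groups in Three Variables*, Ann. of Math. Stud. 123 (1990), §1.10 p. 9, §4.9 p. 54.
* [Casselman1995] W. Casselman, *Introduction to the theory of admissible representations of p-adic reductive groups* (1995), Prop. 1.4.4.
-/

set_option autoImplicit false
-- the mandated namespace repeats the single-problem summit's segment (`HodgeConjecture.HodgeConjecture`)
set_option linter.dupNamespace false

noncomputable section

open MeasureTheory Measure Set Filter Topology
open scoped NNReal ENNReal Pointwise Matrix MatrixGroups WithZero
open ValuativeRel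
open Literature.NumberTheory.Automorphic Literature.NumberTheory.Automorphic.UnitaryGroup Literature.NumberTheory.Rogawski1990

namespace Summit.HodgeConjecture.HodgeConjecture.Cruxes.H413.K2E3SupercuspidalTruncatedCharThm20

variable {K : Type*} [Field K] [Valued K ℤᵐ⁰] [ValuativeRel K] [(Valued.v : Valuation K ℤᵐ⁰).Compatible] [IsNonarchimedeanLocalField K]

set_option synthInstance.maxHeartbeats 400000 in
set_option maxHeartbeats 1600000 in
-- instance-term unification on the model carriers
/-- **THE SHELL VANISHING `∫_{Ω n ∖ Ω R} θ(x g x⁻¹) dx = 0` FOR `g = y t y⁻¹` SPLIT-REGULAR** (`t = diag d` regular, any `y`), `θ = B u' (ρ(·) u)` a coefficient of a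
smooth supercuspidal `ρ` of `U(σ, Φ₃)(K)`, `μ` a left- and right-invariant Haar measure, `Ω` the height-ball exhaustion: ONE radius `R` serves every `n`.
Theorem 20 (★ `cuspForm_cancellation_levelOne_U3_of_isCompact`) fed with ★ [M1] (`hcusp`, `hcuspbar` for the Haar measures of `N`, `N̄`) and `hsupp`, then ★ (f1).
[cite: HarishChandra1970, Part VII §2 Theorem 20 p. 70; §3 p. 71 eq. (1)] [cite: Rogawski1990, §4.9 p. 54] -/
theorem setIntegral_sdiff_heightBall_coeff_conj_eq_zero [SecondCountableTopology K] [SecondCountableTopology (GL (Fin 3) K)]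
    [MeasurableSpace K] [BorelSpace K]
    (σ : K →+* K) (hσ : ∀ x, σ (σ x) = x) (hσc : Continuous σ) (hσv : ∀ x, Valued.v (σ x) = Valued.v x) (h2 : (2 : K) ≠ 0)
    {J : Matrix (Fin 3) (Fin 3) K} (hJ : J = (StdForm.antidiagonal 3).over K)
    [MeasurableSpace ↥(unitaryGroupOfForm σ J)] [BorelSpace ↥(unitaryGroupOfForm σ J)]
    [SecondCountableTopology ↥(unitaryGroupOfForm σ J)] [LocallyCompactSpace ↥(unitaryGroupOfForm σ J)]
    (μ : Measure ↥(unitaryGroupOfForm σ J)) [μ.IsHaarMeasure] [μ.IsMulRightInvariant]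
    {ϖ : K} (hϖ : Valued.v ϖ = WithZero.exp (-1 : ℤ)) {ϖ' : K} (hϖ'0 : ϖ' ≠ 0) (hϖ'1 : valuation K ϖ' < 1) (hσϖ' : σ ϖ' = ϖ')
    (hZs : ∀ z ∈ Subgroup.center ↥(unitaryGroupOfForm σ J), ∃ c : Kˣ,
      ((z : ↥(unitaryGroupOfForm σ J)) : GL (Fin 3) K) = Matrix.GeneralLinearGroup.scalar (Fin 3) c)
    (hZc : IsCompact ((Subgroup.center ↥(unitaryGroupOfForm σ J) : Subgroup ↥(unitaryGroupOfForm σ J)) : Set ↥(unitaryGroupOfForm σ J)))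
    (Ω : CompactExhaustion ↥(unitaryGroupOfForm σ J))
    (hmem : ∀ (m : ℕ) (g : ↥(unitaryGroupOfForm σ J)), g ∈ Ω m ↔
      (∀ i j, Valued.v (ϖ ^ m * ((g : GL (Fin 3) K) : Matrix (Fin 3) (Fin 3) K) i j) ≤ 1) ∧
        ∀ i j, Valued.v (ϖ ^ m * (((g : GL (Fin 3) K)⁻¹ : GL (Fin 3) K) : Matrix (Fin 3) (Fin 3) K) i j) ≤ 1)
    (hinv : ∀ (m : ℕ) (g : ↥(unitaryGroupOfForm σ J)), g ∈ Ω m → g⁻¹ ∈ Ω m)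
    (hmul : ∀ (a b : ℕ) (g h : ↥(unitaryGroupOfForm σ J)), g ∈ Ω a → h ∈ Ω b → g * h ∈ Ω (a + b))
    {V : Type*} [AddCommGroup V] [Module ℂ V] (ρ : Representation ℂ ↥(unitaryGroupOfForm σ J) V) (hsm : ρ.IsSmooth) (hsc : ρ.IsSupercuspidal)
    (B : V →ₗ⋆[ℂ] V →ₗ[ℂ] ℂ) (hBinv : ∀ (g : ↥(unitaryGroupOfForm σ J)) (x y : V), B (ρ g x) (ρ g y) = B x y) (u u' : V)
    (t : ↥(unitaryGroupOfForm σ J)) {d : Fin 3 → Kˣ} (hd : glDiagonal 3 K d = (t : GL (Fin 3) K)) (hreg : IsRegularElt (t : GL (Fin 3) K))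
    (hsupp : ∃ C : Set ↥(unitaryGroupOfForm σ J), IsCompact C ∧ ∀ x : ↥(unitaryGroupOfForm σ J), B u' (ρ (x * t * x⁻¹) u) ≠ 0 →
      x ∈ C * ((torusU σ J : Subgroup ↥(unitaryGroupOfForm σ J)) : Set ↥(unitaryGroupOfForm σ J)))
    (y : ↥(unitaryGroupOfForm σ J)) :
    ∃ R : ℕ, ∀ n : ℕ, ∫ x in Ω n \ Ω R, B u' (ρ (x * (y * t * y⁻¹) * x⁻¹) u) ∂μ = 0 := by
  haveI : T2Space K := (Literature.NumberTheory.GaloisRepresentations.IsNonarchimedeanLocalField.isLocalField K).toT2Space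
  -- `N` and `N̄` are closed subgroups of the locally compact `U`: Haar measures on both
  have hN : IsClosed (((borelTriple σ J hJ).N : Subgroup ↥(unitaryGroupOfForm σ J)) : Set ↥(unitaryGroupOfForm σ J)) :=
    (isClosed_upperUnitriangular (n := 3) (R := K)).preimage continuous_subtype_val
  have hNbar : IsClosed ((((borelTriple σ J hJ).N).map (MulAut.conj (weylLongU σ hJ)).toMonoidHom : Subgroup ↥(unitaryGroupOfForm σ J)) :
      Set ↥(unitaryGroupOfForm σ J)) := by
    have himg : ((((borelTriple σ J hJ).N).map (MulAut.conj (weylLongU σ hJ)).toMonoidHom : Subgroup ↥(unitaryGroupOfForm σ J)) :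
        Set ↥(unitaryGroupOfForm σ J)) =
        ((Homeomorph.mulLeft (weylLongU σ hJ)).trans (Homeomorph.mulRight (weylLongU σ hJ)⁻¹)) ''
          (((borelTriple σ J hJ).N : Subgroup ↥(unitaryGroupOfForm σ J)) : Set ↥(unitaryGroupOfForm σ J)) := by
      rw [Subgroup.coe_map]
      rfl
    rw [himg]
    exact (Homeomorph.isClosed_image _).2 hN
  -- (the subtype measurable structures on `↥N`, `↥N̄` are Borel: Mathlib `Subtype.borelSpace`)
  haveI : LocallyCompactSpace ↥((borelTriple σ J hJ).N) := hN.isClosedEmbedding_subtypeVal.locallyCompactSpace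
  haveI : LocallyCompactSpace ↥(((borelTriple σ J hJ).N).map (MulAut.conj (weylLongU σ hJ)).toMonoidHom) :=
    hNbar.isClosedEmbedding_subtypeVal.locallyCompactSpace
  haveI : SecondCountableTopology ↥((borelTriple σ J hJ).N) := TopologicalSpace.Subtype.secondCountableTopology _
  haveI : SecondCountableTopology ↥(((borelTriple σ J hJ).N).map (MulAut.conj (weylLongU σ hJ)).toMonoidHom) :=
    TopologicalSpace.Subtype.secondCountableTopology _
  set ν : Measure ↥((borelTriple σ J hJ).N) := Measure.haar with hν
  set νbar : Measure ↥(((borelTriple σ J hJ).N).map (MulAut.conj (weylLongU σ hJ)).toMonoidHom) := Measure.haar with hνbar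
  -- the slice `f_t` is a cusp form (★ [M1])
  have hf : Continuous fun x : ↥(unitaryGroupOfForm σ J) => B u' (ρ (x * t * x⁻¹) u) :=
    K2E3SupercuspOrbitalSliceCuspidalModel.continuous_coeff_conj σ ρ hsm B t u u'
  have hcusp : ∀ x : ↥(unitaryGroupOfForm σ J), ∫ n : ↥((borelTriple σ J hJ).N),
      (fun x : ↥(unitaryGroupOfForm σ J) => B u' (ρ (x * t * x⁻¹) u)) (x * ↑n) ∂ν = 0 := fun x =>
    K2E3SupercuspOrbitalSliceCuspidalModel.integral_coeff_slice_unipotentU_eq_zero_of_isSupercuspidal σ hσ hσc h2 hJ hZs hZc hϖ'0 hϖ'1 hσϖ'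
      ρ hsm hsc B hBinv ν t hd hreg u u' x
  have hcuspbar : ∀ x : ↥(unitaryGroupOfForm σ J), ∫ v : ↥(((borelTriple σ J hJ).N).map (MulAut.conj (weylLongU σ hJ)).toMonoidHom),
      (fun x : ↥(unitaryGroupOfForm σ J) => B u' (ρ (x * t * x⁻¹) u)) (x * ↑v) ∂νbar = 0 := fun x =>
    K2E3SupercuspOrbitalSliceCuspidalModel.integral_coeff_slice_unipotentU_map_conj_weylLongU_eq_zero_of_isSupercuspidal σ hσ hσc h2 hJ hZs hZc
      hϖ'0 hϖ'1 hσϖ' ρ hsm hsc B hBinv νbar t hd hreg u u' x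
  -- THEOREM 20 on the full level `K₁`
  obtain ⟨mC, h20⟩ := K2E3CuspFormCancellationU3LevelOne.cuspForm_cancellation_levelOne_U3_of_isCompact σ hσc hσv hJ μ ν νbar hϖ Ω hmem hinv hmul
    (fun x : ↥(unitaryGroupOfForm σ J) => B u' (ρ (x * t * x⁻¹) u)) hf hsupp hcusp hcuspbar
  obtain ⟨s, hy⟩ := Ω.exists_mem y
  refine ⟨mC + (1 + 2 * s + 4 * mC) + s, fun n => ?_⟩
  -- the level `K₁ = U ∩ GL₃(𝒪)`: compact, open, inside `Ω 0`
  obtain ⟨hK₁c, hK₁o⟩ := isCompact_isOpen_comap_congruenceGL σ hσc (γ := (1 : ValueGroupWithZero K)) one_ne_zero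
  have hK₁Ω : (((congruenceGL 3 (1 : ValueGroupWithZero K)).comap (unitaryGroupOfForm σ J).subtype : Subgroup ↥(unitaryGroupOfForm σ J)) :
      Set ↥(unitaryGroupOfForm σ J)) ⊆ Ω 0 :=
    K2E3CuspFormCancellationU3Inputs.coe_level_subset_heightBall_zero σ Ω hmem 1
  -- the shell `Ω n ∖ Ω R` is measurable, relatively compact and right-`K₁`-invariant
  have hSm : MeasurableSet (Ω n \ Ω (mC + (1 + 2 * s + 4 * mC) + s)) :=
    (Ω.isCompact n).measurableSet.diff (Ω.isCompact _).measurableSet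
  have hSc : IsCompact (closure (Ω n \ Ω (mC + (1 + 2 * s + 4 * mC) + s))) := (Ω.isCompact n).closure_of_subset sdiff_subset
  have hSK : ∀ x ∈ Ω n \ Ω (mC + (1 + 2 * s + 4 * mC) + s),
      ∀ k ∈ ((congruenceGL 3 (1 : ValueGroupWithZero K)).comap (unitaryGroupOfForm σ J).subtype : Subgroup ↥(unitaryGroupOfForm σ J)),
        x * k ∈ Ω n \ Ω (mC + (1 + 2 * s + 4 * mC) + s) := by
    intro x hx k hk
    refine ⟨by simpa using hmul n 0 x k hx.1 (hK₁Ω hk), fun hxk => hx.2 ?_⟩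
    simpa using hmul _ 0 (x * k) k⁻¹ hxk (hinv 0 k (hK₁Ω hk))
  -- Theorem 20 kills every `K₁`-average on the shell
  have hφ : Continuous fun z : ↥(unitaryGroupOfForm σ J) => B u' (ρ (z * (y * t * y⁻¹) * z⁻¹) u) :=
    K2E3SupercuspOrbitalSliceCuspidalModel.continuous_coeff_conj σ ρ hsm B (y * t * y⁻¹) u u'
  have h0 : ∀ x ∈ Ω n \ Ω (mC + (1 + 2 * s + 4 * mC) + s),
      ∫ k in (((congruenceGL 3 (1 : ValueGroupWithZero K)).comap (unitaryGroupOfForm σ J).subtype : Subgroup ↥(unitaryGroupOfForm σ J)) :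
        Set ↥(unitaryGroupOfForm σ J)), B u' (ρ (x * k * (y * t * y⁻¹) * (x * k)⁻¹) u) ∂μ = 0 := by
    intro x hx
    have h := h20 s y hy x hx.2
    rw [← h]
    refine setIntegral_congr_fun hK₁o.measurableSet fun k _ => ?_
    congr 2
    group
  exact K2E3RightInvariantSetIntegralVanishing.setIntegral_eq_zero_of_forall_setIntegral_mul_eq_zero μ _ hK₁c
    (hK₁o.measure_ne_zero μ ⟨1, Subgroup.one_mem _⟩) hSm hSc hSK _ hφ h0

set_option synthInstance.maxHeartbeats 400000 in
set_option maxHeartbeats 1600000 in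
-- instance-term unification on the model carriers
/-- **THE TWO CONSUMER SHAPES AT A SPLIT-REGULAR `g = y t y⁻¹`** (model side): with `Θₙ(g) := ∫_{Ω n} B u' (ρ(x g x⁻¹) u) dμ(x)`, ONE radius `R = R(g)` gives
`Θₙ(g) = ∫_{Ω n ∩ Ω R} B u' (ρ(x g x⁻¹) u) dμ` for every `n` (the `hcanc` shape of ★ `K2E3SupercuspidalTruncatedCharDominationOfBricks`, compact ball `Ω R`) AND
`Θₙ(g) → Θ_R(g)` (the `hlim` shape of ★ `K2E3CharLocIntNearSemisimpleSupercuspidalOfTruncated`, `F g := Θ_R(g)`).  The shell vanishing ∘ ★ (f1) §4.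
[cite: HarishChandra1970, Part VII §3 p. 71 eq. (1), p. 72] -/
theorem exists_heightBall_truncatedCoeff_eq_inter_and_tendsto [SecondCountableTopology K] [SecondCountableTopology (GL (Fin 3) K)]
    [MeasurableSpace K] [BorelSpace K]
    (σ : K →+* K) (hσ : ∀ x, σ (σ x) = x) (hσc : Continuous σ) (hσv : ∀ x, Valued.v (σ x) = Valued.v x) (h2 : (2 : K) ≠ 0)
    {J : Matrix (Fin 3) (Fin 3) K} (hJ : J = (StdForm.antidiagonal 3).over K)
    [MeasurableSpace ↥(unitaryGroupOfForm σ J)] [BorelSpace ↥(unitaryGroupOfForm σ J)]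
    [SecondCountableTopology ↥(unitaryGroupOfForm σ J)] [LocallyCompactSpace ↥(unitaryGroupOfForm σ J)]
    (μ : Measure ↥(unitaryGroupOfForm σ J)) [μ.IsHaarMeasure] [μ.IsMulRightInvariant]
    {ϖ : K} (hϖ : Valued.v ϖ = WithZero.exp (-1 : ℤ)) {ϖ' : K} (hϖ'0 : ϖ' ≠ 0) (hϖ'1 : valuation K ϖ' < 1) (hσϖ' : σ ϖ' = ϖ')
    (hZs : ∀ z ∈ Subgroup.center ↥(unitaryGroupOfForm σ J), ∃ c : Kˣ,
      ((z : ↥(unitaryGroupOfForm σ J)) : GL (Fin 3) K) = Matrix.GeneralLinearGroup.scalar (Fin 3) c)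
    (hZc : IsCompact ((Subgroup.center ↥(unitaryGroupOfForm σ J) : Subgroup ↥(unitaryGroupOfForm σ J)) : Set ↥(unitaryGroupOfForm σ J)))
    (Ω : CompactExhaustion ↥(unitaryGroupOfForm σ J))
    (hmem : ∀ (m : ℕ) (g : ↥(unitaryGroupOfForm σ J)), g ∈ Ω m ↔
      (∀ i j, Valued.v (ϖ ^ m * ((g : GL (Fin 3) K) : Matrix (Fin 3) (Fin 3) K) i j) ≤ 1) ∧
        ∀ i j, Valued.v (ϖ ^ m * (((g : GL (Fin 3) K)⁻¹ : GL (Fin 3) K) : Matrix (Fin 3) (Fin 3) K) i j) ≤ 1)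
    (hinv : ∀ (m : ℕ) (g : ↥(unitaryGroupOfForm σ J)), g ∈ Ω m → g⁻¹ ∈ Ω m)
    (hmul : ∀ (a b : ℕ) (g h : ↥(unitaryGroupOfForm σ J)), g ∈ Ω a → h ∈ Ω b → g * h ∈ Ω (a + b))
    {V : Type*} [AddCommGroup V] [Module ℂ V] (ρ : Representation ℂ ↥(unitaryGroupOfForm σ J) V) (hsm : ρ.IsSmooth) (hsc : ρ.IsSupercuspidal)
    (B : V →ₗ⋆[ℂ] V →ₗ[ℂ] ℂ) (hBinv : ∀ (g : ↥(unitaryGroupOfForm σ J)) (x y : V), B (ρ g x) (ρ g y) = B x y) (u u' : V)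
    (t : ↥(unitaryGroupOfForm σ J)) {d : Fin 3 → Kˣ} (hd : glDiagonal 3 K d = (t : GL (Fin 3) K)) (hreg : IsRegularElt (t : GL (Fin 3) K))
    (hsupp : ∃ C : Set ↥(unitaryGroupOfForm σ J), IsCompact C ∧ ∀ x : ↥(unitaryGroupOfForm σ J), B u' (ρ (x * t * x⁻¹) u) ≠ 0 →
      x ∈ C * ((torusU σ J : Subgroup ↥(unitaryGroupOfForm σ J)) : Set ↥(unitaryGroupOfForm σ J)))
    (y : ↥(unitaryGroupOfForm σ J)) :
    ∃ R : ℕ, (∀ n : ℕ, ∫ x in Ω n, B u' (ρ (x * (y * t * y⁻¹) * x⁻¹) u) ∂μ = ∫ x in Ω n ∩ Ω R, B u' (ρ (x * (y * t * y⁻¹) * x⁻¹) u) ∂μ) ∧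
      Tendsto (fun n : ℕ => ∫ x in Ω n, B u' (ρ (x * (y * t * y⁻¹) * x⁻¹) u) ∂μ) atTop
        (𝓝 (∫ x in Ω R, B u' (ρ (x * (y * t * y⁻¹) * x⁻¹) u) ∂μ)) := by
  haveI : T2Space K := (Literature.NumberTheory.GaloisRepresentations.IsNonarchimedeanLocalField.isLocalField K).toT2Space
  obtain ⟨R, hR⟩ := setIntegral_sdiff_heightBall_coeff_conj_eq_zero σ hσ hσc hσv h2 hJ μ hϖ hϖ'0 hϖ'1 hσϖ' hZs hZc Ω hmem hinv hmul ρ hsm hsc B hBinv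
    u u' t hd hreg hsupp y
  have hφ : Continuous fun z : ↥(unitaryGroupOfForm σ J) => B u' (ρ (z * (y * t * y⁻¹) * z⁻¹) u) :=
    K2E3SupercuspOrbitalSliceCuspidalModel.continuous_coeff_conj σ ρ hsm B (y * t * y⁻¹) u u'
  have hmeas : ∀ n, MeasurableSet (Ω n) := fun n => (Ω.isCompact n).measurableSet
  have hint : ∀ n, IntegrableOn (fun z : ↥(unitaryGroupOfForm σ J) => B u' (ρ (z * (y * t * y⁻¹) * z⁻¹) u)) (Ω n) μ := fun n =>
    hφ.continuousOn.integrableOn_compact (Ω.isCompact n)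
  exact ⟨R, K2E3RightInvariantSetIntegralVanishing.setIntegral_eq_setIntegral_inter_of_sdiff_eq_zero μ Ω hmeas R _ hint hR,
    K2E3RightInvariantSetIntegralVanishing.tendsto_setIntegral_of_forall_sdiff_eq_zero μ Ω (fun _ _ h => Ω.subset h) hmeas R _ hint hR⟩

end Summit.HodgeConjecture.HodgeConjecture.Cruxes.H413.K2E3SupercuspidalTruncatedCharThm20

end
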